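import Summits.KontsevichZagierPeriods.KontsevichZagierPeriods.Theorems.HurwitzMicroSectorsNormalFormPrincipleL2W3ExistsWordRep

/-!
# `NormalFormPrinciple` (stmt-KontsevichZagierPeriods-3869), line `SketchIdeator1` —
# layer `L2W3` (level-2 weight-3 descent): the sixteen word carriers, packaged

Pure proof file (lead seat c9; `--supports` the crux). The four assemblies of the layer
(FiveEighthsZetaThree, HalfPointZetaThree, HalfPointDuality, HalfPointZetaTwoLogTwo) consume the
relation packages `l2w3_relations_*`, whose carriers are hypotheses written with the letters
`a(u) = 1/u`, `b(u) = 1/(1−u)`, `c(u) = 1/(1+u)`, `d(u) = 1/(2−u)` spelled out. This file obtains all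
sixteen word representations `[Δ, x(t₀)y(t₁)z(t₂)]` needed (`aab, abb, aac, acc, abc, acb, cbb, cbc,
ccb, ccc, cab, cac, aad, dad, add, dab`) from the landed existence theorem `l2w3_exists_wordRep` and
re-reads their integrands in exactly that spelled-out form (a `funext`/`ring` reassociation), so that
each assembly starts with one `obtain`. Sources: M. Kontsevich, D. Zagier, *Periods* (2001), §1.1.
No definitions are introduced.
-/

noncomputable section

open MeasureTheory Set
open Literature.NumberTheory.Transcendental Literature.NumberTheory.Transcendental.KZ

namespace Summit.KontsevichZagierPeriods.HurwitzMicroSectors.NormalFormPrinciple.PiBox.M3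

/-- **The sixteen word carriers of the level-2 weight-3 descent exist**, with integrands written
letter by letter (`1/t`, `1/(1−t)`, `1/(1+t)`, `1/(2−t)`) in the form consumed by the relation
packages `l2w3_relations_dilation / _moebius_* / _reflection / l2w3_relation_shuffle`.
[cite: KontsevichZagier2001, §1.1] -/
theorem l2w3_carriers :
    ∃ (AAB ABB AAC ACC ABC ACB CBB CBC CCB CCC CAB CAC AAD DAD ADD DAB : IntegralRep 3),
      (AAB.domain = {t | 0 < t 2 ∧ t 2 < t 1 ∧ t 1 < t 0 ∧ t 0 < 1} ∧
        (AAB.integrand = fun t => 1 / t 0 * 1 / t 1 * (1 / (1 - t 2)))) ∧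
      (ABB.domain = {t | 0 < t 2 ∧ t 2 < t 1 ∧ t 1 < t 0 ∧ t 0 < 1} ∧
        (ABB.integrand = fun t => 1 / t 0 * (1 / (1 - t 1)) * (1 / (1 - t 2)))) ∧
      (AAC.domain = {t | 0 < t 2 ∧ t 2 < t 1 ∧ t 1 < t 0 ∧ t 0 < 1} ∧
        (AAC.integrand = fun t => 1 / t 0 * 1 / t 1 * (1 / (1 + t 2)))) ∧
      (ACC.domain = {t | 0 < t 2 ∧ t 2 < t 1 ∧ t 1 < t 0 ∧ t 0 < 1} ∧
        (ACC.integrand = fun t => 1 / t 0 * (1 / (1 + t 1)) * (1 / (1 + t 2)))) ∧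
      (ABC.domain = {t | 0 < t 2 ∧ t 2 < t 1 ∧ t 1 < t 0 ∧ t 0 < 1} ∧
        (ABC.integrand = fun t => 1 / t 0 * (1 / (1 - t 1)) * (1 / (1 + t 2)))) ∧
      (ACB.domain = {t | 0 < t 2 ∧ t 2 < t 1 ∧ t 1 < t 0 ∧ t 0 < 1} ∧
        (ACB.integrand = fun t => 1 / t 0 * (1 / (1 + t 1)) * (1 / (1 - t 2)))) ∧
      (CBB.domain = {t | 0 < t 2 ∧ t 2 < t 1 ∧ t 1 < t 0 ∧ t 0 < 1} ∧
        (CBB.integrand = fun t => 1 / (1 + t 0) * (1 / (1 - t 1)) * (1 / (1 - t 2)))) ∧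
      (CBC.domain = {t | 0 < t 2 ∧ t 2 < t 1 ∧ t 1 < t 0 ∧ t 0 < 1} ∧
        (CBC.integrand = fun t => 1 / (1 + t 0) * (1 / (1 - t 1)) * (1 / (1 + t 2)))) ∧
      (CCB.domain = {t | 0 < t 2 ∧ t 2 < t 1 ∧ t 1 < t 0 ∧ t 0 < 1} ∧
        (CCB.integrand = fun t => 1 / (1 + t 0) * (1 / (1 + t 1)) * (1 / (1 - t 2)))) ∧
      (CCC.domain = {t | 0 < t 2 ∧ t 2 < t 1 ∧ t 1 < t 0 ∧ t 0 < 1} ∧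
        (CCC.integrand = fun t => 1 / (1 + t 0) * (1 / (1 + t 1)) * (1 / (1 + t 2)))) ∧
      (CAB.domain = {t | 0 < t 2 ∧ t 2 < t 1 ∧ t 1 < t 0 ∧ t 0 < 1} ∧
        (CAB.integrand = fun t => 1 / (1 + t 0) * 1 / t 1 * (1 / (1 - t 2)))) ∧
      (CAC.domain = {t | 0 < t 2 ∧ t 2 < t 1 ∧ t 1 < t 0 ∧ t 0 < 1} ∧
        (CAC.integrand = fun t => 1 / (1 + t 0) * 1 / t 1 * (1 / (1 + t 2)))) ∧
      (AAD.domain = {t | 0 < t 2 ∧ t 2 < t 1 ∧ t 1 < t 0 ∧ t 0 < 1} ∧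
        (AAD.integrand = fun t => 1 / t 0 * 1 / t 1 * (1 / (2 - t 2)))) ∧
      (DAD.domain = {t | 0 < t 2 ∧ t 2 < t 1 ∧ t 1 < t 0 ∧ t 0 < 1} ∧
        (DAD.integrand = fun t => 1 / (2 - t 0) * 1 / t 1 * (1 / (2 - t 2)))) ∧
      (ADD.domain = {t | 0 < t 2 ∧ t 2 < t 1 ∧ t 1 < t 0 ∧ t 0 < 1} ∧
        (ADD.integrand = fun t => 1 / t 0 * (1 / (2 - t 1)) * (1 / (2 - t 2)))) ∧
      (DAB.domain = {t | 0 < t 2 ∧ t 2 < t 1 ∧ t 1 < t 0 ∧ t 0 < 1} ∧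
        (DAB.integrand = fun t => 1 / (2 - t 0) * 1 / t 1 * (1 / (1 - t 2)))) := by
  obtain ⟨AAB, hAABd, hAABi⟩ := l2w3_exists_wordRep (fun u => 1 / u) (fun u => 1 / u) (fun u => 1 / (1 - u))
    (Or.inl rfl) (Or.inl rfl) (Or.inl rfl)
  obtain ⟨ABB, hABBd, hABBi⟩ := l2w3_exists_wordRep (fun u => 1 / u) (fun u => 1 / (1 - u)) (fun u => 1 / (1 - u))
    (Or.inl rfl) (Or.inr (Or.inl rfl)) (Or.inl rfl)
  obtain ⟨AAC, hAACd, hAACi⟩ := l2w3_exists_wordRep (fun u => 1 / u) (fun u => 1 / u) (fun u => 1 / (1 + u))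
    (Or.inl rfl) (Or.inl rfl) (Or.inr (Or.inl rfl))
  obtain ⟨ACC, hACCd, hACCi⟩ := l2w3_exists_wordRep (fun u => 1 / u) (fun u => 1 / (1 + u)) (fun u => 1 / (1 + u))
    (Or.inl rfl) (Or.inr (Or.inr (Or.inl rfl))) (Or.inr (Or.inl rfl))
  obtain ⟨ABC, hABCd, hABCi⟩ := l2w3_exists_wordRep (fun u => 1 / u) (fun u => 1 / (1 - u)) (fun u => 1 / (1 + u))
    (Or.inl rfl) (Or.inr (Or.inl rfl)) (Or.inr (Or.inl rfl))
  obtain ⟨ACB, hACBd, hACBi⟩ := l2w3_exists_wordRep (fun u => 1 / u) (fun u => 1 / (1 + u)) (fun u => 1 / (1 - u))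
    (Or.inl rfl) (Or.inr (Or.inr (Or.inl rfl))) (Or.inl rfl)
  obtain ⟨CBB, hCBBd, hCBBi⟩ := l2w3_exists_wordRep (fun u => 1 / (1 + u)) (fun u => 1 / (1 - u)) (fun u => 1 / (1 - u))
    (Or.inr (Or.inl rfl)) (Or.inr (Or.inl rfl)) (Or.inl rfl)
  obtain ⟨CBC, hCBCd, hCBCi⟩ := l2w3_exists_wordRep (fun u => 1 / (1 + u)) (fun u => 1 / (1 - u)) (fun u => 1 / (1 + u))
    (Or.inr (Or.inl rfl)) (Or.inr (Or.inl rfl)) (Or.inr (Or.inl rfl))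
  obtain ⟨CCB, hCCBd, hCCBi⟩ := l2w3_exists_wordRep (fun u => 1 / (1 + u)) (fun u => 1 / (1 + u)) (fun u => 1 / (1 - u))
    (Or.inr (Or.inl rfl)) (Or.inr (Or.inr (Or.inl rfl))) (Or.inl rfl)
  obtain ⟨CCC, hCCCd, hCCCi⟩ := l2w3_exists_wordRep (fun u => 1 / (1 + u)) (fun u => 1 / (1 + u)) (fun u => 1 / (1 + u))
    (Or.inr (Or.inl rfl)) (Or.inr (Or.inr (Or.inl rfl))) (Or.inr (Or.inl rfl))
  obtain ⟨CAB, hCABd, hCABi⟩ := l2w3_exists_wordRep (fun u => 1 / (1 + u)) (fun u => 1 / u) (fun u => 1 / (1 - u))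
    (Or.inr (Or.inl rfl)) (Or.inl rfl) (Or.inl rfl)
  obtain ⟨CAC, hCACd, hCACi⟩ := l2w3_exists_wordRep (fun u => 1 / (1 + u)) (fun u => 1 / u) (fun u => 1 / (1 + u))
    (Or.inr (Or.inl rfl)) (Or.inl rfl) (Or.inr (Or.inl rfl))
  obtain ⟨AAD, hAADd, hAADi⟩ := l2w3_exists_wordRep (fun u => 1 / u) (fun u => 1 / u) (fun u => 1 / (2 - u))
    (Or.inl rfl) (Or.inl rfl) (Or.inr (Or.inr (rfl)))
  obtain ⟨DAD, hDADd, hDADi⟩ := l2w3_exists_wordRep (fun u => 1 / (2 - u)) (fun u => 1 / u) (fun u => 1 / (2 - u))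
    (Or.inr (Or.inr (rfl))) (Or.inl rfl) (Or.inr (Or.inr (rfl)))
  obtain ⟨ADD, hADDd, hADDi⟩ := l2w3_exists_wordRep (fun u => 1 / u) (fun u => 1 / (2 - u)) (fun u => 1 / (2 - u))
    (Or.inl rfl) (Or.inr (Or.inr (Or.inr (rfl)))) (Or.inr (Or.inr (rfl)))
  obtain ⟨DAB, hDABd, hDABi⟩ := l2w3_exists_wordRep (fun u => 1 / (2 - u)) (fun u => 1 / u) (fun u => 1 / (1 - u))
    (Or.inr (Or.inr (rfl))) (Or.inl rfl) (Or.inl rfl)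
  refine ⟨AAB, ABB, AAC, ACC, ABC, ACB, CBB, CBC, CCB, CCC, CAB, CAC, AAD, DAD, ADD, DAB, ⟨hAABd, hAABi.trans (funext fun t => by ring)⟩, ⟨hABBd, hABBi⟩, ⟨hAACd, hAACi.trans (funext fun t => by ring)⟩, ⟨hACCd, hACCi⟩, ⟨hABCd, hABCi⟩, ⟨hACBd, hACBi⟩, ⟨hCBBd, hCBBi⟩, ⟨hCBCd, hCBCi⟩, ⟨hCCBd, hCCBi⟩, ⟨hCCCd, hCCCi⟩, ⟨hCABd, hCABi.trans (funext fun t => by ring)⟩, ⟨hCACd, hCACi.trans (funext fun t => by ring)⟩, ⟨hAADd, hAADi.trans (funext fun t => by ring)⟩, ⟨hDADd, hDADi.trans (funext fun t => by ring)⟩, ⟨hADDd, hADDi⟩, ⟨hDABd, hDABi.trans (funext fun t => by ring)⟩⟩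

end Summit.KontsevichZagierPeriods.HurwitzMicroSectors.NormalFormPrinciple.PiBox.M3
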